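import Literature.NumberTheory.Sieve.LargestPrimeFactorCubicRegion
import Literature.NumberTheory.Sieve.LargestPrimeFactorCubicCubeCover
import Literature.NumberTheory.Sieve.LargestPrimeFactorCubicCCondCount
import HarnessLib

/-!
# Heath-Brown 2001 (PLMS), §8: bookkeeping between the generator family `regionGens`, the grid
# cubes of `…CubeSum`/`…CubeCover`, and the pairs `(a, b)` of `…CCondCount`

Topic `Literature/NumberTheory/Sieve`; a PROVED structural layer (no named facts) under the named fact
`Irving2015_largestPrimeFactor_cubic` (`LargestPrimeFactorCubic.lean`).  Source: D. R. Heath-Brown,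
*The largest prime factor of `X³ + 2`*, Proc. London Math. Soc. (3) 82 (2001) 554–596, §8 p. 30: the
generators are grouped into the disjoint good cubes `𝓑 = (A,A+M] × (B,B+M] × (C,C+M]`, and within a
cube by the pair `(a, b)` ((8.3): "the sum over `a, b` is restricted by the condition (2.17)").  This
file PROVES, for `m ≥ 1`:

* `closedCube_eq_gridCube` — the closed cube with corner `(mk₁, mk₂, mk₃)` is `gridCube m k`;
  `isGoodCube_iff_goodIdx` — `IsGoodCube X m (m·k) ↔ GoodIdx N₁ N₂ M₃ m k` (`N₁ = X^{1+3δ/2}`, …);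
* `goodCorners_eq_image` — `goodCorners X m = (m · goodSet …).image`, and
  **`sum_regionGens_eq`** — `∑_{v ∈ regionGens X m} F v = ∑_{k ∈ goodSet} ∑_{v ∈ cubePoints (m·k) m, (2.15)–(2.17), (2.11)} F v`
  (the cubes are pairwise disjoint);
* `sum_cubePoints_filter_eq` — within a cube: `∑_{v} = ∑_{(a,b) ∈ face, IsBasePair} ∑_{c ∈ (C,C+m], CCond}`;
* **`hbPair_of_good`** — for `(a, b)` on the face of a good cube, `q = a³ − 2b³ > 0` and
  `HBPair a b q.natAbs`, and `ccond_iff` — `CCond (a,b,c) ↔` the `gcd` conditions with the natural `q`.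

## References

* D. R. Heath-Brown, *The largest prime factor of `X³ + 2`*, Proc. London Math. Soc. (3) 82 (2001)
  554–596, §8 p. 30 ((8.3)), (2.11), (2.15)–(2.17). [`HeathBrown2001LargestPrimeFactorCubic`]

## Mathlib / tree search

Tree: `regionGens`, `goodCorners`, `cornerGrid`, `cubePoints`, `closedCube`, `IsGoodCube`, `InRegion`,
`CCond`, `rvec`, `rvec_mem_closedCube` (`…Region`); `gridCube`, `GoodIdx`, `goodSet`, `InBox`
(`…CubeSum`, `…GoodCubes`, `…CubeCover`); `HBPair` (`…CCondCount`); `IsBasePair`, `qf`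
(`…Setup`).  Mathlib: `Finset.sum_biUnion`, `Finset.sum_image`, `Set.PairwiseDisjoint`.
-/

noncomputable section

open Finset Real

namespace Literature.NumberTheory.Sieve.HeathBrown2001

open LargestPrimeFactorCubic CubicSieve

/-! ### Cubes: `closedCube (m·k) m = gridCube m k` -/

/-- The corner `m·k` as a triple of naturals. [folklore] -/
def cornerNat (m : ℕ) (k : ℕ × ℕ × ℕ) : ℕ × ℕ × ℕ := (m * k.1, m * k.2.1, m * k.2.2)

/-- `closedCube (m·k) m = gridCube m k`. [folklore] -/
theorem closedCube_eq_gridCube (m : ℕ) (k : ℕ × ℕ × ℕ) :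
    closedCube (cornerNat m k) m = gridCube (m : ℝ) k := by
  ext x
  simp only [closedCube, cornerNat, gridCube, Set.mem_setOf_eq, Set.mem_prod, Set.mem_Icc]
  push_cast
  constructor
  · rintro ⟨⟨h1, h2⟩, ⟨h3, h4⟩, ⟨h5, h6⟩⟩
    refine ⟨⟨by linarith, by linarith⟩, ⟨by linarith, by linarith⟩, ⟨by linarith, by linarith⟩⟩
  · rintro ⟨⟨h1, h2⟩, ⟨h3, h4⟩, ⟨h5, h6⟩⟩
    refine ⟨⟨by linarith, by linarith⟩, ⟨by linarith, by linarith⟩, ⟨by linarith, by linarith⟩⟩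

/-- `IsGoodCube X m (m·k) ↔ GoodIdx X^{1+3δ/2} X^{1+2δ} X^{1+δ} m k`. [folklore] -/
theorem isGoodCube_iff_goodIdx (X m : ℕ) (k : ℕ × ℕ × ℕ) :
    IsGoodCube X m (cornerNat m k) ↔
      GoodIdx ((X : ℝ) ^ (1 + 3 * hbδ / 2)) ((X : ℝ) ^ (1 + 2 * hbδ)) ((X : ℝ) ^ (1 + hbδ)) (m : ℝ) k := by
  unfold IsGoodCube GoodIdx
  rw [closedCube_eq_gridCube]
  rfl

/-! ### The good corners as an image of the good indices -/

/-- The grid range `K = 8⌈N⌉ + 1`. [folklore] -/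
def gridK (X : ℕ) : ℕ := 8 * ⌈Npar X⌉₊ + 1

open scoped Classical in
/-- `goodCorners X m` is the image of `goodSet … m (gridK X)` under `k ↦ m·k`. [folklore] -/
theorem goodCorners_eq_image (X m : ℕ) :
    goodCorners X m = (goodSet ((X : ℝ) ^ (1 + 3 * hbδ / 2)) ((X : ℝ) ^ (1 + 2 * hbδ)) ((X : ℝ) ^ (1 + hbδ))
      (m : ℝ) (gridK X)).image (cornerNat m) := by
  ext ABC
  rw [goodCorners, mem_filter, cornerGrid, mem_image, mem_image]
  constructor
  · rintro ⟨⟨k, hk, rfl⟩, hgood⟩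
    refine ⟨k, ?_, rfl⟩
    rw [goodSet, mem_filter]
    exact ⟨by simpa [gridK] using hk, (isGoodCube_iff_goodIdx X m k).mp hgood⟩
  · rintro ⟨k, hk, rfl⟩
    rw [goodSet, mem_filter] at hk
    exact ⟨⟨k, by simpa [gridK] using hk.1, rfl⟩, (isGoodCube_iff_goodIdx X m k).mpr hk.2⟩

/-- `k ↦ m·k` is injective for `m ≥ 1`. [folklore] -/
theorem cornerNat_injective {m : ℕ} (hm : 0 < m) : Function.Injective (cornerNat m) := by
  intro k k' h
  simp only [cornerNat, Prod.mk.injEq] at h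
  obtain ⟨h1, h2, h3⟩ := h
  exact Prod.ext (Nat.eq_of_mul_eq_mul_left hm h1)
    (Prod.ext (Nat.eq_of_mul_eq_mul_left hm h2) (Nat.eq_of_mul_eq_mul_left hm h3))

/-- Distinct grid corners give disjoint cube point sets. [folklore] -/
theorem disjoint_cubePoints {m : ℕ} {k k' : ℕ × ℕ × ℕ} (h : k ≠ k') :
    Disjoint (cubePoints (cornerNat m k) m) (cubePoints (cornerNat m k') m) := by
  rw [disjoint_left]
  intro v hv hv'
  apply h
  simp only [cubePoints, cornerNat, mem_product, mem_Ioc] at hv hv'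
  -- in each coordinate, `m k < v ≤ m k + m` pins down `k`
  have key : ∀ {a b t : ℕ}, m * a < t → t ≤ m * a + m → m * b < t → t ≤ m * b + m → a = b := by
    intro a b t h1 h2 h3 h4
    by_contra hne
    rcases Nat.lt_or_gt_of_ne hne with h | h
    · have := Nat.mul_le_mul_left m (Nat.succ_le_of_lt h)
      rw [Nat.mul_succ] at this; omega
    · have := Nat.mul_le_mul_left m (Nat.succ_le_of_lt h)
      rw [Nat.mul_succ] at this; omega
  obtain ⟨⟨a1, a2⟩, ⟨a3, a4⟩, ⟨a5, a6⟩⟩ := hv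
  obtain ⟨⟨b1, b2⟩, ⟨b3, b4⟩, ⟨b5, b6⟩⟩ := hv'
  exact Prod.ext (key a1 a2 b1 b2) (Prod.ext (key a3 a4 b3 b4) (key a5 a6 b5 b6))

open scoped Classical in
/-- **Decomposition of a sum over `regionGens` by cubes** (`m ≥ 1`).
[cite: HeathBrown2001LargestPrimeFactorCubic, §8 p. 30 ((8.3))] -/
theorem sum_regionGens_eq {X m : ℕ} (hm : 0 < m) (F : (ℕ × ℕ × ℕ) → ℝ) :
    ∑ v ∈ regionGens X m, F v =
      ∑ k ∈ goodSet ((X : ℝ) ^ (1 + 3 * hbδ / 2)) ((X : ℝ) ^ (1 + 2 * hbδ)) ((X : ℝ) ^ (1 + hbδ)) (m : ℝ) (gridK X),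
        ∑ v ∈ (cubePoints (cornerNat m k) m).filter (fun v => IsBasePair X (v.1, v.2.1) ∧ CCond v), F v := by
  rw [regionGens, goodCorners_eq_image X m, sum_biUnion, sum_image]
  · intro k _ k' _ h; exact cornerNat_injective hm h
  · -- pairwise disjointness of the filtered cube point sets
    intro ABC hABC ABC' hABC' hne
    rw [coe_image, Set.mem_image] at hABC hABC'
    obtain ⟨k, hk, rfl⟩ := hABC
    obtain ⟨k', hk', rfl⟩ := hABC'
    have hkk : k ≠ k' := fun h => hne (by rw [h])
    exact (disjoint_cubePoints hkk).mono (filter_subset _ _) (filter_subset _ _)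

/-! ### Within a cube: the face `(a, b)` and the edge `c` -/

open scoped Classical in
/-- **`∑_{v ∈ cube, (2.15)–(2.17), (2.11)} F = ∑_{(a,b) ∈ face, IsBasePair} ∑_{c ∈ (C,C+m], CCond(a,b,c)} F(a,b,c)`**.
[cite: HeathBrown2001LargestPrimeFactorCubic, §8 p. 30 ((8.3))] -/
theorem sum_cubePoints_filter_eq (X m : ℕ) (ABC : ℕ × ℕ × ℕ) (F : (ℕ × ℕ × ℕ) → ℝ) :
    ∑ v ∈ (cubePoints ABC m).filter (fun v => IsBasePair X (v.1, v.2.1) ∧ CCond v), F v =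
      ∑ ab ∈ (Ioc ABC.1 (ABC.1 + m) ×ˢ Ioc ABC.2.1 (ABC.2.1 + m)).filter (IsBasePair X),
        ∑ c ∈ (Ioc ABC.2.2 (ABC.2.2 + m)).filter (fun c => CCond (ab.1, ab.2, c)), F (ab.1, ab.2, c) := by
  have lhs : ∑ v ∈ (cubePoints ABC m).filter (fun v => IsBasePair X (v.1, v.2.1) ∧ CCond v), F v =
      ∑ a ∈ Ioc ABC.1 (ABC.1 + m), ∑ b ∈ Ioc ABC.2.1 (ABC.2.1 + m), ∑ c ∈ Ioc ABC.2.2 (ABC.2.2 + m),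
        if IsBasePair X (a, b) ∧ CCond (a, b, c) then F (a, b, c) else 0 := by
    rw [cubePoints, sum_filter, sum_product]
    refine sum_congr rfl fun a _ => ?_
    rw [sum_product]
  have rhs : ∑ ab ∈ (Ioc ABC.1 (ABC.1 + m) ×ˢ Ioc ABC.2.1 (ABC.2.1 + m)).filter (IsBasePair X),
      ∑ c ∈ (Ioc ABC.2.2 (ABC.2.2 + m)).filter (fun c => CCond (ab.1, ab.2, c)), F (ab.1, ab.2, c) =
      ∑ a ∈ Ioc ABC.1 (ABC.1 + m), ∑ b ∈ Ioc ABC.2.1 (ABC.2.1 + m),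
        if IsBasePair X (a, b) then ∑ c ∈ Ioc ABC.2.2 (ABC.2.2 + m), (if CCond (a, b, c) then F (a, b, c) else 0) else 0 := by
    rw [sum_filter, sum_product]
    refine sum_congr rfl fun a _ => sum_congr rfl fun b _ => ?_
    split_ifs
    · rw [sum_filter]
    · rfl
  rw [lhs, rhs]
  refine sum_congr rfl fun a _ => sum_congr rfl fun b _ => ?_
  by_cases hab : IsBasePair X (a, b)
  · rw [if_pos hab]
    refine sum_congr rfl fun c _ => ?_
    by_cases hc : CCond (a, b, c)
    · rw [if_pos ⟨hab, hc⟩, if_pos hc]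
    · rw [if_neg (fun h => hc h.2), if_neg hc]
  · rw [if_neg hab]
    exact sum_eq_zero fun c _ => if_neg fun h => hab h.1

/-! ### The pair `(a, b)` of a good cube: `q > 0`, `HBPair`, `CCond` -/

/-- On the face of a good cube (i.e. for a lattice point of it): `q = a³ − 2b³ > 0`.
[cite: HeathBrown2001LargestPrimeFactorCubic, §8 p. 30 ("x₁³ − 2x₂³ > M³")] -/
theorem qf_pos_of_good {X m : ℕ} {ABC v : ℕ × ℕ × ℕ} (hgood : IsGoodCube X m ABC)
    (hv : v ∈ cubePoints ABC m) : 0 < qf v.1 v.2.1 := by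
  have hR := hgood _ (rvec_mem_closedCube hv)
  obtain ⟨-, -, -, -, h5⟩ := hR
  have hpos : (0 : ℝ) < (v.1 : ℝ) ^ 3 - 2 * (v.2.1 : ℝ) ^ 3 := by
    have : (0 : ℝ) ≤ (X : ℝ) ^ (1 + hbδ) := by positivity
    simp only [rvec] at h5
    linarith
  have : ((qf v.1 v.2.1 : ℤ) : ℝ) = (v.1 : ℝ) ^ 3 - 2 * (v.2.1 : ℝ) ^ 3 := by rw [qf]; push_cast; ring
  exact_mod_cast (this ▸ hpos : (0 : ℝ) < ((qf v.1 v.2.1 : ℤ) : ℝ))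

/-- **`HBPair a b q`** for a base pair on a good cube, `q = (a³ − 2b³).natAbs`.
[cite: HeathBrown2001LargestPrimeFactorCubic, (2.15)–(2.16)] -/
theorem hbPair_of_good {X m : ℕ} {ABC v : ℕ × ℕ × ℕ} (hgood : IsGoodCube X m ABC)
    (hv : v ∈ cubePoints ABC m) (hbase : IsBasePair X (v.1, v.2.1)) :
    HBPair v.1 v.2.1 (qf v.1 v.2.1).natAbs := by
  have hq := qf_pos_of_good hgood hv
  obtain ⟨hsq, hcop, -⟩ := hbase
  refine ⟨?_, hsq, hcop⟩
  rw [Int.natCast_natAbs, abs_of_pos hq, qf]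

/-- `CCond (a, b, c)` is the pair of `gcd` conditions with the natural `q = (a³ − 2b³).natAbs` when `q > 0`.
[cite: HeathBrown2001LargestPrimeFactorCubic, (2.11)] -/
theorem ccond_iff {a b c : ℕ} (hq : 0 < qf a b) :
    CCond (a, b, c) ↔
      (Int.gcd ((b : ℤ) ^ 2 - a * c) ((qf a b).natAbs : ℕ) = 1 ∧
        Int.gcd ((a : ℤ) ^ 2 + b * c) ((qf a b).natAbs : ℕ) = 1) := by
  have : (((qf a b).natAbs : ℕ) : ℤ) = qf a b := by rw [Int.natCast_natAbs, abs_of_pos hq]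
  rw [CCond, this]

end Literature.NumberTheory.Sieve.HeathBrown2001
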